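import Literature.Probability.Percolation.AdjFourArmCyclic
import Literature.Probability.Percolation.AnnulusOrderTransfer
import HarnessLib

/-!
# The adjacent four-arm event with CLEAN arms: heredity in both radii by order transfer

Topic `Literature/Probability/Percolation`; family `crit-perc`. Definitions with bodies and proofs
only (no named fact). Serves the named fact `Literature.Probability.Percolation.Werner2009_lemma63`
(W. Werner, PCMI 2009, Lecture 6, Lemma 6.3 for the tree's ORDER-FREE `π̂_t`), whose proof in the
tree (`Werner2009_lemma63_of_altSeparation_of_adjSeparation`, `ArcFourArmStability.lean`) has as
its last missing input Nolin's arm-separation theorem (EJP 13 (2008), Thm. 11 [arXiv 0711.4948: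
Thm. 10]) for four arms in the ADJACENT colour arrangement `σ = BBWW`, below `L(p)`. The proof
of that theorem (§4.4: "`A_{j,σ}(2^k, 2^K) ⊆ Ã^{·/η'}_{j,σ}(2^k, 2^K) ∪ ({one of the U-shaped regions
fails} ∩ A_{j,σ}(2^k, 2^{K-1}))`", iterated) restricts the arms to smaller annuli at every failed
scale, so it needs the event `A_{4,BBWW}(n, R)` in a form that is HEREDITARY in the outer radius
`R` (and, for the internal extremities, in the inner radius). On the lattice the cyclic order of a
family of arms is read off the outer extremities (`adjFourArmCyc`, `AdjFourArmCyclic.lean`), and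
the order of the truncated arms on a smaller circle is the same only by a planarity argument —
the order transfer across a slit annulus (`IsSlit.hexShift_lt_iff`, `AnnulusOrderTransfer.lean`,
Bollobás–Riordan 2006, Ch. 7 Lemma 5). This file packages it:

* `adjFourArmClean r R` — **`A_{4,BBWW}(r, R)` with clean arms**: `adjFourArmCyc r R` whose arms
  meet `∂Λ_r` only at their start and `∂Λ_R` only at their end (every arm family can be cleaned:
  last visit of `∂Λ_r`, then first visit of `∂Λ_R`);
* `adjFourArmClean_subset_adjFourArmCyc`, `adjFourArmCyc_subset_clean_union_alt` — clean families
  are families; conversely a family, cleaned, is either cyclically adjacent or interleaved, and in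
  the latter case the configuration is alternating in cluster form (`mem_altFourArm_of_hexSep`):
  `adjFourArmCyc r R ⊆ adjFourArmClean r R ∪ altFourArm r R`, whence
  `armEvent TFTF r R = altFourArm r R ∪ adjFourArmClean r R` and
  `P(adjFourArmCyc) ≤ P(adjFourArmClean) + π̂^alt`;
* `hexSep_iff_xor_hexShift` — separation of two pairs of perimeter points as an exclusive or of
  two comparisons of anticlockwise shifts from one of the points;
* `hexSep_outer_iff_inner` — **for a clean family the outer order is the inner order**: with the
  arm `0` as the slit of `{r ≤ |v| ≤ R}`, the outer extremities of the closed arms separate those of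
  the open arms iff, anticlockwise from `x 0` on `∂Λ_r`, exactly one of `x 1`, `x 3` comes before
  `x 2` (two applications of `IsSlit.hexShift_lt_iff`);
* `adjFourArmClean_anti` — **heredity in the outer radius** (`1 ≤ r`, `r + 2 ≤ R' ≤ R`): truncate
  the arms at their first visit of `∂Λ_{R'}`; the starts are unchanged, so the inner order, hence
  the outer order, is unchanged;
* `adjFourArmClean_mono_left` — heredity in the inner radius (final segments after the last visit
  of `∂Λ_{r'}`; the ends are unchanged);
* locality, measurability, colour-flip invariance (`compl_preimage_adjFourArmClean`).

## References

* P. Nolin, Near-critical percolation in two dimensions, *Electron. J. Probab.* 13 (2008), §4.1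
  (`A_{j,σ}`, colour sequences up to cyclic permutation), §4.4 proof of Thm. 11 (arXiv 0711.4948:
  Thm. 10, p. 12: the failed scales) [Nolin2008].
* B. Bollobás, O. Riordan, *Percolation*, Cambridge University Press (2006), Ch. 7, Lemma 5
  p. 169 [BollobasRiordan2006].
* W. Werner, *Lectures on two-dimensional critical percolation*, IAS/Park City Math. Ser. 16
  (2009), Lecture 6, Lemma 6.3 [WernerPCMI2009].

## Mathlib / tree

Tree: `adjFourArmCyc`, `HexSep`, `HexBtw`, `mem_altFourArm_of_hexSep`, `hexPos_ne_of_disjoint`,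
`vecTFTF_succ` (`AdjFourArmCyclic.lean`); `IsSlit`, `IsSlit.hexShift_lt_iff`
(`AnnulusOrderTransfer.lean`); `hexPos`, `hexShift`, `hexPos_range`, `hexPos_injOn`
(`TriBallDisc.lean`); `triWalkTruncAt` and its specs (`ArmEventsProofs.lean`); `altFourArm`,
`triAnn`, `mem_triAnn_of_support`; `armEvent`, `IsColouredPath`, `PathIn.of_walk`,
`PathIn.of_walk_mem_support`; `DeterminedBy`.
-/

noncomputable section

open Set MeasureTheory

namespace Literature.Probability.Percolation

open LatticeModels

/-! ### Truncation at the first visit of a level is clean -/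

/-- **The truncated walk meets the level `R` only at its end** (it stops at the FIRST vertex of
norm `R`). [cite: SmirnovWernerMRL2001, §3] -/
theorem triWalkTruncAt_clean (R : ℤ) {x y : Site 2} (w : triGraph.Walk x y) :
    ∀ v ∈ (triWalkTruncAt R w).2.support, triNorm v = R → v = (triWalkTruncAt R w).1 := by
  induction w with
  | nil =>
    intro v hv _
    simp only [triWalkTruncAt_nil, SimpleGraph.Walk.support_nil, List.mem_singleton] at hv
    simp only [triWalkTruncAt_nil]
    exact hv
  | @cons u u' z h p ih =>
    intro v hv hvR
    by_cases hu : triNorm u = R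
    · rw [triWalkTruncAt_cons_of_eq R h p hu] at hv ⊢
      simp only [SimpleGraph.Walk.support_nil, List.mem_singleton] at hv
      exact hv
    · rw [triWalkTruncAt_cons_of_ne R h p hu] at hv ⊢
      simp only [SimpleGraph.Walk.support_cons, List.mem_cons] at hv
      rcases hv with rfl | hv
      · exact absurd hvR hu
      · exact ih v hv hvR

/-! ### The clean adjacent event -/

/-- **`A_{4,BBWW}(r, R)` with clean arms**: four pairwise disjoint self-avoiding `𝕋`-paths across
`{r ≤ |·|_𝕋 ≤ R}` of colours open, closed, open, closed, whose closed outer extremities do not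
separate the open ones on `∂Λ_R` (as in `adjFourArmCyc`), and which meet `∂Λ_r` only at their
start and `∂Λ_R` only at their end. [cite: Nolin2008, §4.1 (A_{j,σ}, σ up to cyclic permutation; BBWW)] -/
def adjFourArmClean (r R : ℕ) : Set (SiteConfig (Site 2)) :=
  {ω | ∃ (x y : Fin 4 → Site 2) (w : ∀ j, triGraph.Walk (x j) (y j)),
    (∀ j, x j ∈ triSphere r ∧ y j ∈ triSphere R ∧ (w j).IsPath ∧
      (∀ v ∈ (w j).support, v ∈ (↑(triBall R) : Set (Site 2)) \ ↑(triBall r) ∨ v ∈ triSphere r) ∧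
      IsColouredPath ω (![true, false, true, false] j) (w j)) ∧
    (Pairwise fun i j => Disjoint (w i).support.toFinset (w j).support.toFinset) ∧
    ¬ HexSep (hexPos R (y 1)) (hexPos R (y 3)) (hexPos R (y 0)) (hexPos R (y 2)) ∧
    (∀ j, ∀ v ∈ (w j).support, triNorm v = r → v = x j) ∧
    (∀ j, ∀ v ∈ (w j).support, triNorm v = R → v = y j)}

/-- Clean adjacent families are adjacent families. [cite: Nolin2008, §4.1] -/
theorem adjFourArmClean_subset_adjFourArmCyc (r R : ℕ) :
    adjFourArmClean r R ⊆ adjFourArmCyc r R := by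
  rintro ω ⟨x, y, w, hw, hdisj, hord, -, -⟩
  exact ⟨x, y, w, hw, hdisj, hord⟩

/-- Clean adjacent families are four-arm families. [cite: Nolin2008, §4.1] -/
theorem adjFourArmClean_subset_armEvent (r R : ℕ) :
    adjFourArmClean r R ⊆ armEvent ![true, false, true, false] r R :=
  (adjFourArmClean_subset_adjFourArmCyc r R).trans (adjFourArmCyc_subset_armEvent r R)

/-! ### Cleaning a family: final segments and initial segments -/

section Family

variable {ω : SiteConfig (Site 2)} {x y : Fin 4 → Site 2} {w : ∀ j, triGraph.Walk (x j) (y j)}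

/-- **Final segments** (as `altFourArm_mono_left`, `armEvent_mono_left`): for `r ≤ r' ≤ R`, the
segments of the arms after their last visit of `∂Λ_{r'}` form a family across `{r' ≤ |·| ≤ R}`
with the same ends, contained in the old arms, meeting `∂Λ_{r'}` only at their starts. [cite: SmirnovWernerMRL2001, §3] [cite: Nolin2008, §4.1] -/
theorem exists_suffix_family {r r' R : ℕ} (hr : r ≤ r') (hR : r' ≤ R)
    (hw : ∀ j, x j ∈ triSphere r ∧ y j ∈ triSphere R ∧ (w j).IsPath ∧
      (∀ v ∈ (w j).support, v ∈ (↑(triBall R) : Set (Site 2)) \ ↑(triBall r) ∨ v ∈ triSphere r) ∧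
      IsColouredPath ω (![true, false, true, false] j) (w j))
    (hdisj : Pairwise fun i j => Disjoint (w i).support.toFinset (w j).support.toFinset) :
    ∃ (x' : Fin 4 → Site 2) (w' : ∀ j, triGraph.Walk (x' j) (y j)),
      (∀ j, x' j ∈ triSphere r' ∧ y j ∈ triSphere R ∧ (w' j).IsPath ∧
        (∀ v ∈ (w' j).support, v ∈ (↑(triBall R) : Set (Site 2)) \ ↑(triBall r') ∨ v ∈ triSphere r') ∧
        IsColouredPath ω (![true, false, true, false] j) (w' j)) ∧
      (Pairwise fun i j => Disjoint (w' i).support.toFinset (w' j).support.toFinset) ∧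
      (∀ j, ∀ v ∈ (w' j).support, v ∈ (w j).support) ∧
      (∀ j, ∀ v ∈ (w' j).support, triNorm v = r' → v = x' j) := by
  classical
  have hsub : ∀ l, ∀ v, v ∈ (triWalkTruncAt (r' : ℤ) (w l).reverse).2.reverse.support →
      v ∈ (w l).support := by
    intro l v hv
    rw [SimpleGraph.Walk.support_reverse, List.mem_reverse] at hv
    have := support_triWalkTruncAt_subset _ _ hv
    rwa [SimpleGraph.Walk.support_reverse, List.mem_reverse] at this
  refine ⟨fun j => (triWalkTruncAt r' (w j).reverse).1,
    fun j => (triWalkTruncAt r' (w j).reverse).2.reverse, fun j => ?_, ?_, hsub, fun j v hv hvr => ?_⟩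
  · obtain ⟨hx, hy, hpath, hsupp, hcol⟩ := hw j
    have hxn : triNorm (x j) = r := mem_triSphere_iff.1 hx
    have hyn : triNorm (y j) = R := mem_triSphere_iff.1 hy
    obtain ⟨hend, hge⟩ := triWalkTruncAt_spec_down (r' : ℤ) (w j).reverse (by omega) (by omega)
    refine ⟨mem_triSphere_iff.2 hend, hy, ?_, fun v hv => ?_, fun v hv => hcol v (hsub j v hv)⟩
    · exact (isPath_triWalkTruncAt _ hpath.reverse).reverse
    · have hv' : (r' : ℤ) ≤ triNorm v := by
        apply hge
        rw [SimpleGraph.Walk.support_reverse, List.mem_reverse] at hv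
        exact hv
      have hvR : triNorm v ≤ R :=
        (mem_triAnnulus.1 (mem_triAnnulus_of_arm (hr.trans hR) (hsupp v (hsub j v hv)))).2
      rcases eq_or_lt_of_le hv' with h | h
      · right
        rw [mem_triSphere_iff, ← h]
      · left
        simp only [Set.mem_sdiff, Finset.mem_coe, mem_triBall_iff, not_le]
        exact ⟨hvR, h⟩
  · intro i j hij
    refine Finset.disjoint_left.2 fun v hvi hvj => ?_
    exact Finset.disjoint_left.1 (hdisj hij)
      (List.mem_toFinset.2 (hsub i v (List.mem_toFinset.1 hvi)))
      (List.mem_toFinset.2 (hsub j v (List.mem_toFinset.1 hvj)))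
  · have hv' : v ∈ (triWalkTruncAt (r' : ℤ) (w j).reverse).2.support := by
      rw [SimpleGraph.Walk.support_reverse, List.mem_reverse] at hv
      exact hv
    exact triWalkTruncAt_clean (r' : ℤ) (w j).reverse v hv' hvr

/-- **Initial segments** (as `altFourArm_anti`, `armEvent_mono`): for `r ≤ R' ≤ R`, the arms
truncated at their first visit of `∂Λ_{R'}` form a family across `{r ≤ |·| ≤ R'}` with the same
starts, contained in the old arms, meeting `∂Λ_{R'}` only at their ends. [cite: SmirnovWernerMRL2001, §3] [cite: Nolin2008, §4.1] -/
theorem exists_prefix_family {r R' R : ℕ} (hr : r ≤ R') (hR : R' ≤ R)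
    (hw : ∀ j, x j ∈ triSphere r ∧ y j ∈ triSphere R ∧ (w j).IsPath ∧
      (∀ v ∈ (w j).support, v ∈ (↑(triBall R) : Set (Site 2)) \ ↑(triBall r) ∨ v ∈ triSphere r) ∧
      IsColouredPath ω (![true, false, true, false] j) (w j))
    (hdisj : Pairwise fun i j => Disjoint (w i).support.toFinset (w j).support.toFinset) :
    ∃ (y' : Fin 4 → Site 2) (w' : ∀ j, triGraph.Walk (x j) (y' j)),
      (∀ j, x j ∈ triSphere r ∧ y' j ∈ triSphere R' ∧ (w' j).IsPath ∧
        (∀ v ∈ (w' j).support, v ∈ (↑(triBall R') : Set (Site 2)) \ ↑(triBall r) ∨ v ∈ triSphere r) ∧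
        IsColouredPath ω (![true, false, true, false] j) (w' j)) ∧
      (Pairwise fun i j => Disjoint (w' i).support.toFinset (w' j).support.toFinset) ∧
      (∀ j, ∀ v ∈ (w' j).support, v ∈ (w j).support) ∧
      (∀ j, ∀ v ∈ (w' j).support, triNorm v = R' → v = y' j) := by
  refine ⟨fun j => (triWalkTruncAt R' (w j)).1, fun j => (triWalkTruncAt R' (w j)).2, fun j => ?_, ?_,
    fun j v hv => support_triWalkTruncAt_subset _ _ hv,
    fun j v hv hvR => triWalkTruncAt_clean (R' : ℤ) (w j) v hv hvR⟩
  · obtain ⟨hx, hy, hpath, hsupp, hcol⟩ := hw j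
    have hxn : triNorm (x j) = r := mem_triSphere_iff.1 hx
    have hyn : triNorm (y j) = R := mem_triSphere_iff.1 hy
    obtain ⟨hend, hle⟩ := triWalkTruncAt_spec_up (R' : ℤ) (w j) (by omega) (by omega)
    refine ⟨hx, mem_triSphere_iff.2 hend, isPath_triWalkTruncAt _ hpath, fun v hv => ?_,
      fun v hv => hcol v (support_triWalkTruncAt_subset _ _ hv)⟩
    have hvR : triNorm v ≤ R' := hle v hv
    rcases hsupp v (support_triWalkTruncAt_subset _ _ hv) with hv' | hv'
    · left
      simp only [Set.mem_sdiff, Finset.mem_coe, mem_triBall_iff] at hv' ⊢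
      exact ⟨hvR, hv'.2⟩
    · exact Or.inr hv'
  · intro i j hij
    refine Finset.disjoint_left.2 fun v hvi hvj => ?_
    exact Finset.disjoint_left.1 (hdisj hij)
      (List.mem_toFinset.2 (support_triWalkTruncAt_subset _ _ (List.mem_toFinset.1 hvi)))
      (List.mem_toFinset.2 (support_triWalkTruncAt_subset _ _ (List.mem_toFinset.1 hvj)))

end Family

/-! ### Separation of perimeter points as an exclusive or of shifts -/

/-- **`{b, d}` separates `{a, c}` on `∂Λ_K` iff, anticlockwise from `a`, exactly one of `b`, `d`
comes before `c`** (four distinct sites of `∂Λ_K`, `K ≥ 1`). [folklore] -/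
theorem hexSep_iff_xor_hexShift {K : ℕ} (hK : 1 ≤ K) {a b c d : Site 2} (ha : triNorm a = K)
    (hb : triNorm b = K) (hc : triNorm c = K) (hd : triNorm d = K)
    (hab : a ≠ b) (hac : a ≠ c) (had : a ≠ d) (hbc : b ≠ c) (hbd : b ≠ d) (hcd : c ≠ d) :
    HexSep (hexPos K b) (hexPos K d) (hexPos K a) (hexPos K c) ↔
      Xor (hexShift K a b < hexShift K a c) (hexShift K a d < hexShift K a c) := by
  have ra := hexPos_range hK ha
  have rb := hexPos_range hK hb
  have rc := hexPos_range hK hc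
  have rd := hexPos_range hK hd
  have nab : hexPos K a ≠ hexPos K b := fun e => hab (hexPos_injOn hK ha hb e)
  have nac : hexPos K a ≠ hexPos K c := fun e => hac (hexPos_injOn hK ha hc e)
  have nad : hexPos K a ≠ hexPos K d := fun e => had (hexPos_injOn hK ha hd e)
  have nbc : hexPos K b ≠ hexPos K c := fun e => hbc (hexPos_injOn hK hb hc e)
  have nbd : hexPos K b ≠ hexPos K d := fun e => hbd (hexPos_injOn hK hb hd e)
  have ncd : hexPos K c ≠ hexPos K d := fun e => hcd (hexPos_injOn hK hc hd e)
  unfold HexSep HexBtw hexShift Xor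
  split_ifs <;> omega

/-! ### Order transfer for clean families -/

section Clean

variable {ω : SiteConfig (Site 2)} {x y : Fin 4 → Site 2} {w : ∀ j, triGraph.Walk (x j) (y j)}

/-- **For a clean family the outer order is the inner order.** If four pairwise disjoint arms
across `{r ≤ |·| ≤ R}` (`1 ≤ r`, `r + 2 ≤ R`) meet `∂Λ_r` only at their starts `x j` and `∂Λ_R`
only at their ends `y j`, then `{y 1, y 3}` separates `{y 0, y 2}` on `∂Λ_R` iff, anticlockwise from
`x 0` on `∂Λ_r`, exactly one of `x 1`, `x 3` comes before `x 2`: the arm `0` is a slit of the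
annulus and the three other arms are paths of its complement (`IsSlit.hexShift_lt_iff`, twice). [cite: BollobasRiordan2006, Ch. 7 Lemma 5 p. 169] [cite: Nolin2008, §4.1] -/
theorem hexSep_outer_iff_inner {r R : ℕ} (h1 : 1 ≤ r) (h2 : r + 2 ≤ R)
    (hw : ∀ j, x j ∈ triSphere r ∧ y j ∈ triSphere R ∧ (w j).IsPath ∧
      (∀ v ∈ (w j).support, v ∈ (↑(triBall R) : Set (Site 2)) \ ↑(triBall r) ∨ v ∈ triSphere r) ∧
      IsColouredPath ω (![true, false, true, false] j) (w j))
    (hdisj : Pairwise fun i j => Disjoint (w i).support.toFinset (w j).support.toFinset)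
    (hin : ∀ j, ∀ v ∈ (w j).support, triNorm v = r → v = x j)
    (hout : ∀ j, ∀ v ∈ (w j).support, triNorm v = R → v = y j) :
    HexSep (hexPos R (y 1)) (hexPos R (y 3)) (hexPos R (y 0)) (hexPos R (y 2)) ↔
      Xor (hexShift r (x 0) (x 1) < hexShift r (x 0) (x 2))
        (hexShift r (x 0) (x 3) < hexShift r (x 0) (x 2)) := by
  classical
  have hrR : r ≤ R := by omega
  have hR1 : 1 ≤ R := by omega
  have hxn : ∀ j, triNorm (x j) = r := fun j => mem_triSphere_iff.1 (hw j).1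
  have hyn : ∀ j, triNorm (y j) = R := fun j => mem_triSphere_iff.1 (hw j).2.1
  have hann : ∀ j, ∀ v ∈ (w j).support, v ∈ triAnn r R := fun j v hv =>
    mem_triAnn_of_support hrR ((hw j).2.2.2.1 v hv)
  have hdj : ∀ {i j : Fin 4}, i ≠ j → ∀ v ∈ (w i).support, v ∉ (w j).support := by
    intro i j hij v hvi hvj
    exact Finset.disjoint_left.1 (hdisj hij) (List.mem_toFinset.2 hvi) (List.mem_toFinset.2 hvj)
  -- the slit: the support of the arm `0`
  set S : Set (Site 2) := {v | v ∈ (w 0).support} with hS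
  have hslit : IsSlit r R S (x 0) (y 0) :=
    { one_le := h1
      le := h2
      norm_s := hxn 0
      norm_t := hyn 0
      mem_t := (w 0).end_mem_support
      sub := fun v hv => hann 0 v hv
      conn := fun v hv => (PathIn.of_walk_mem_support (A := S) (w 0) (fun z hz => hz) hv).1
      clean_in := fun v hv hvr => hin 0 v hv hvr
      clean_out := fun v hv hvR => hout 0 v hv hvR }
  -- the comparison lemma for an arm `i` against the arm `2`
  have key : ∀ i : Fin 4, i ≠ 0 → i ≠ 2 →
      (hexShift r (x 0) (x i) < hexShift r (x 0) (x 2) ↔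
        hexShift R (y 0) (y i) < hexShift R (y 0) (y 2)) := by
    intro i hi0 hi2
    set X : Set (Site 2) := {v | v ∈ (w i).support} with hX
    have hXsub : X ⊆ triAnn r R \ S := fun v hv => ⟨hann i v hv, hdj hi0 v hv⟩
    have hQ : PathIn triGraph X (x i) (y i) := PathIn.of_walk (w i) fun v hv => hv
    have hRp : PathIn triGraph ((triAnn r R \ S) \ X) (x 2) (y 2) :=
      PathIn.of_walk (w 2) fun v hv =>
        ⟨⟨hann 2 v hv, hdj (by decide) v hv⟩, hdj (Ne.symm hi2) v hv⟩
    exact hslit.hexShift_lt_iff hXsub hQ hRp (hxn i) (hyn i) (hxn 2) (hyn 2)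
  have e1 := key 1 (by decide) (by decide)
  have e3 := key 3 (by decide) (by decide)
  -- distinct ends
  have hne : ∀ i j : Fin 4, i ≠ j → y i ≠ y j := by
    intro i j hij e
    apply hdj hij (y i) (w i).end_mem_support
    rw [e]
    exact (w j).end_mem_support
  rw [hexSep_iff_xor_hexShift hR1 (hyn 0) (hyn 1) (hyn 2) (hyn 3) (hne 0 1 (by decide))
    (hne 0 2 (by decide)) (hne 0 3 (by decide)) (hne 1 2 (by decide)) (hne 1 3 (by decide))
    (hne 2 3 (by decide)), e1, e3]

end Clean

/-! ### Heredity -/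

/-- **Heredity in the outer radius** (`1 ≤ r`, `r + 2 ≤ R' ≤ R`): `adjFourArmClean r R ⊆ adjFourArmClean r R'`.
Truncate the arms at their first visit of `∂Λ_{R'}`: the truncated family is clean, with the same
starts, so by `hexSep_outer_iff_inner` (at `R` for the old family, at `R'` for the new one) its
outer extremities are cyclically adjacent as well. This is the lattice form of "the `j` arms
induce `j` arms of the smaller annulus in the same cyclic order" used at every failed scale of
the proof of Nolin's Thm. 11. [cite: Nolin2008, §4.4 (arXiv 0711.4948: proof of Thm. 10, p. 12)] [cite: BollobasRiordan2006, Ch. 7 Lemma 5 p. 169] -/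
theorem adjFourArmClean_anti {r R' R : ℕ} (h1 : 1 ≤ r) (hR' : r + 2 ≤ R') (hR : R' ≤ R) :
    adjFourArmClean r R ⊆ adjFourArmClean r R' := by
  rintro ω ⟨x, y, w, hw, hdisj, hord, hin, hout⟩
  obtain ⟨y', w', hw', hdisj', hsub, hout'⟩ := exists_prefix_family (by omega : r ≤ R') hR hw hdisj
  have hin' : ∀ j, ∀ v ∈ (w' j).support, triNorm v = r → v = x j :=
    fun j v hv hvr => hin j v (hsub j v hv) hvr
  refine ⟨x, y', w', hw', hdisj', ?_, hin', hout'⟩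
  rw [hexSep_outer_iff_inner h1 hR' hw' hdisj' hin' hout',
    ← hexSep_outer_iff_inner h1 (hR'.trans hR) hw hdisj hin hout]
  exact hord

/-- **Heredity in the inner radius** (`r ≤ r' ≤ R`): `adjFourArmClean r R ⊆ adjFourArmClean r' R`
(final segments after the last visit of `∂Λ_{r'}`; the ends, hence the order, are unchanged). [cite: Nolin2008, §4.4 (arXiv 0711.4948: proof of Thm. 10, p. 13, internal extremities)] -/
theorem adjFourArmClean_mono_left {r r' R : ℕ} (hr : r ≤ r') (hR : r' ≤ R) :
    adjFourArmClean r R ⊆ adjFourArmClean r' R := by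
  rintro ω ⟨x, y, w, hw, hdisj, hord, -, hout⟩
  obtain ⟨x', w', hw', hdisj', hsub, hin'⟩ := exists_suffix_family hr hR hw hdisj
  exact ⟨x', y, w', hw', hdisj', hord, hin', fun j v hv hvR => hout j v (hsub j v hv) hvR⟩

/-- **Cleaning a family**: a cyclically adjacent family, reduced to the segments after the last
visit of `∂Λ_r` and then truncated at the first visit of `∂Λ_R`, is a clean family with the same
colours; if its outer extremities are still cyclically adjacent the configuration lies in
`adjFourArmClean r R`, otherwise they are interleaved and the configuration is alternating in
cluster form (`mem_altFourArm_of_hexSep`). (`1 ≤ r ≤ R`.) [cite: Nolin2008, §4.1 (BWBW ≠ BBWW)] [cite: BollobasRiordan2006, Ch. 7 Lemma 5 p. 169] -/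
theorem adjFourArmCyc_subset_clean_union_alt {r R : ℕ} (h1 : 1 ≤ r) (hrR : r ≤ R) :
    adjFourArmCyc r R ⊆ adjFourArmClean r R ∪ altFourArm r R := by
  rintro ω ⟨x, y, w, hw, hdisj, -⟩
  obtain ⟨x', w', hw', hdisj', -, hin'⟩ := exists_suffix_family le_rfl hrR hw hdisj
  obtain ⟨y', w'', hw'', hdisj'', hsub, hout''⟩ := exists_prefix_family hrR le_rfl hw' hdisj'
  have hin'' : ∀ j, ∀ v ∈ (w'' j).support, triNorm v = r → v = x' j :=
    fun j v hv hvr => hin' j v (hsub j v hv) hvr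
  by_cases hsep : HexSep (hexPos R (y' 1)) (hexPos R (y' 3)) (hexPos R (y' 0)) (hexPos R (y' 2))
  · exact Or.inr (mem_altFourArm_of_hexSep h1 hrR hw'' hdisj'' hsep)
  · exact Or.inl ⟨x', y', w'', hw'', hdisj'', hsep, hin'', hout''⟩

/-- `altFourArm r R ⊆ armEvent`, `adjFourArmClean ⊆ armEvent`, and conversely, so **the
order-free four-arm event is the union of the alternating arrangement (cluster form) and the
CLEAN adjacent arrangement** (`1 ≤ r ≤ R`). [cite: Nolin2008, §4.1] [cite: SmirnovWernerMRL2001, §4 (H_j(r, R))] -/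
theorem armEvent_four_eq_altFourArm_union_adjFourArmClean {r R : ℕ} (h1 : 1 ≤ r) (hrR : r ≤ R) :
    armEvent ![true, false, true, false] r R = altFourArm r R ∪ adjFourArmClean r R := by
  refine Set.Subset.antisymm ?_
    (Set.union_subset (altFourArm_subset_armEvent r R) (adjFourArmClean_subset_armEvent r R))
  rw [armEvent_four_eq_altFourArm_union_adjFourArmCyc h1 hrR]
  rintro ω (hω | hω)
  · exact Or.inl hω
  · rcases adjFourArmCyc_subset_clean_union_alt h1 hrR hω with h | h
    · exact Or.inr h
    · exact Or.inl h

/-! ### Locality, measurability, colour flip -/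

/-- `adjFourArmClean r R` is determined by the sites of `triAnnulus r R`. [cite: SmirnovWernerMRL2001, §3] -/
theorem adjFourArmClean_determined {r R : ℕ} (hrR : r ≤ R) (ω ω' : SiteConfig (Site 2))
    (h : ∀ v ∈ triAnnulus r R, (v ∈ ω ↔ v ∈ ω')) :
    ω ∈ adjFourArmClean r R ↔ ω' ∈ adjFourArmClean r R := by
  constructor
  · rintro ⟨x, y, w, hw, hdisj, hord, hin, hout⟩
    refine ⟨x, y, w, fun j => ?_, hdisj, hord, hin, hout⟩
    obtain ⟨hx, hy, hpath, hsupp, hcol⟩ := hw j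
    exact ⟨hx, hy, hpath, hsupp, fun v hv =>
      (h v (mem_triAnnulus_of_arm hrR (hsupp v hv))).symm.trans (hcol v hv)⟩
  · rintro ⟨x, y, w, hw, hdisj, hord, hin, hout⟩
    refine ⟨x, y, w, fun j => ?_, hdisj, hord, hin, hout⟩
    obtain ⟨hx, hy, hpath, hsupp, hcol⟩ := hw j
    exact ⟨hx, hy, hpath, hsupp, fun v hv =>
      (h v (mem_triAnnulus_of_arm hrR (hsupp v hv))).trans (hcol v hv)⟩

/-- `DeterminedBy` form of `adjFourArmClean_determined`. [cite: SmirnovWernerMRL2001, §3] -/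
theorem determinedBy_adjFourArmClean {r R : ℕ} (hrR : r ≤ R) :
    DeterminedBy (adjFourArmClean r R) ↑(triAnnulus r R) := by
  rw [determinedBy_iff]
  intro ω ω' h
  refine adjFourArmClean_determined hrR ω ω' fun v hv => ?_
  have hv' : v ∈ (↑(triAnnulus r R) : Set (Site 2)) := Finset.mem_coe.2 hv
  have key := Set.ext_iff.1 h v
  exact ⟨fun hω => (key.1 ⟨hω, hv'⟩).1, fun hω' => (key.2 ⟨hω', hv'⟩).1⟩

/-- The clean adjacent four-arm event is measurable. [cite: SmirnovWernerMRL2001, §3] -/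
theorem measurableSet_adjFourArmClean {r R : ℕ} (hrR : r ≤ R) : MeasurableSet (adjFourArmClean r R) :=
  (determinedBy_adjFourArmClean hrR).measurableSet_of_finset

/-- **Colour flip = cyclic relabelling**: complementing the configuration maps `adjFourArmClean r R`
(`R ≥ 1`) to itself (as `compl_mem_adjFourArmCyc`; the cleanness clauses relabel). [cite: Nolin2008, §4.1 (WBWB and BWBW are the same sequence)] [cite: SmirnovWernerMRL2001, Rem. 2] -/
theorem compl_mem_adjFourArmClean {r R : ℕ} (hR : 1 ≤ R) {ω : SiteConfig (Site 2)}
    (hω : ω ∈ adjFourArmClean r R) : ωᶜ ∈ adjFourArmClean r R := by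
  obtain ⟨x, y, w, hw, hdisj, hord, hin, hout⟩ := hω
  refine ⟨fun j => x (j + 1), fun j => y (j + 1), fun j => w (j + 1), fun j => ?_, ?_, ?_,
    fun j => hin (j + 1), fun j => hout (j + 1)⟩
  · obtain ⟨hx, hy, hpath, hsupp, hcol⟩ := hw (j + 1)
    refine ⟨hx, hy, hpath, hsupp, ?_⟩
    rw [isColouredPath_compl_iff, ← vecTFTF_succ]
    exact hcol
  · intro i j hij
    exact hdisj fun h => hij (by simpa using h)
  · intro h
    have hyn : ∀ j, triNorm (y j) = R := fun j => mem_triSphere_iff.1 (hw j).2.1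
    have hne : ∀ i j, i ≠ j → hexPos R (y i) ≠ hexPos R (y j) := fun i j hij =>
      hexPos_ne_of_disjoint hR (hyn i) (hyn j) (hdisj hij)
    refine hord (hexSep_comm_right (hexSep_symm (hne 2 1 (by decide)) (hne 2 3 (by decide))
      (hne 0 1 (by decide)) (hne 0 3 (by decide)) ?_))
    simpa using h

/-- `compl ⁻¹' adjFourArmClean r R = adjFourArmClean r R` for `R ≥ 1`. [cite: SmirnovWernerMRL2001, Rem. 2] -/
theorem compl_preimage_adjFourArmClean {r R : ℕ} (hR : 1 ≤ R) :
    compl ⁻¹' adjFourArmClean r R = adjFourArmClean r R := by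
  ext ω
  refine ⟨fun h => ?_, fun h => compl_mem_adjFourArmClean hR h⟩
  have := compl_mem_adjFourArmClean hR (ω := ωᶜ) h
  rwa [compl_compl] at this

/-! ### Probabilities -/

/-- `P(adjFourArmCyc r R) ≤ P(adjFourArmClean r R) + P(altFourArm r R)` for any measure (`1 ≤ r ≤ R`). [cite: Nolin2008, §4.1] -/
theorem measureReal_adjFourArmCyc_le_clean_add_alt (μ : Measure (SiteConfig (Site 2)))
    [IsFiniteMeasure μ] {r R : ℕ} (h1 : 1 ≤ r) (hrR : r ≤ R) :
    μ.real (adjFourArmCyc r R) ≤ μ.real (adjFourArmClean r R) + μ.real (altFourArm r R) :=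
  (measureReal_mono (adjFourArmCyc_subset_clean_union_alt h1 hrR) (measure_ne_top _ _)).trans
    (measureReal_union_le _ _)

/-- **`π̂_t ≤ π̂^alt_t + P_t(adjFourArmClean)`** (`1 ≤ r ≤ R`): the upper half of the sandwich of the
order-free four-arm probability between the alternating one and a clean adjacent host. [cite: WernerPCMI2009, Lecture 6, §4 (π̂_p)] [cite: Nolin2008, §4.1] -/
theorem fourArmProbAt_le_alt_add_clean (t : unitInterval) {r R : ℕ} (h1 : 1 ≤ r) (hrR : r ≤ R) :
    fourArmProbAt t r R ≤ altFourArmProbAt t r R + (triSitePercolation t).real (adjFourArmClean r R) := by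
  unfold fourArmProbAt altFourArmProbAt
  rw [armEvent_four_eq_altFourArm_union_adjFourArmClean h1 hrR]
  exact measureReal_union_le _ _

/-- `P_t(adjFourArmClean r R) ≤ π̂_t(r, R)`. [cite: Nolin2008, §4.1] -/
theorem real_adjFourArmClean_le_fourArmProbAt (t : unitInterval) (r R : ℕ) :
    (triSitePercolation t).real (adjFourArmClean r R) ≤ fourArmProbAt t r R :=
  measureReal_mono (adjFourArmClean_subset_armEvent r R) (measure_ne_top _ _)

/-- `P_t(adjFourArmClean r ·)` is antitone in the outer radius (`1 ≤ r`, `r + 2 ≤ R' ≤ R`). [cite: Nolin2008, §4.4] -/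
theorem real_adjFourArmClean_anti (t : unitInterval) {r R' R : ℕ} (h1 : 1 ≤ r) (hR' : r + 2 ≤ R')
    (hR : R' ≤ R) :
    (triSitePercolation t).real (adjFourArmClean r R) ≤ (triSitePercolation t).real (adjFourArmClean r R') :=
  measureReal_mono (adjFourArmClean_anti h1 hR' hR) (measure_ne_top _ _)

/-- `P_t(adjFourArmClean · R)` is monotone in the inner radius (`r ≤ r' ≤ R`). [cite: Nolin2008, §4.4] -/
theorem real_adjFourArmClean_mono_left (t : unitInterval) {r r' R : ℕ} (hr : r ≤ r') (hR : r' ≤ R) :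
    (triSitePercolation t).real (adjFourArmClean r R) ≤ (triSitePercolation t).real (adjFourArmClean r' R) :=
  measureReal_mono (adjFourArmClean_mono_left hr hR) (measure_ne_top _ _)

end Literature.Probability.Percolation
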